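import Summits.CriticalPhenomena.Ising3D.Control2DL19GapCTable
import Mathlib.Tactic.NormNum
import HarnessLib

/-!
# RB-1 certificate `j129766_functional_deriv2d_L19_E048_eps1.00005.json` (Λ = 19, E₀ = 48): Δ_ε < 20001/20000 at Δ_σ = 1/8 — (R), the large-`S` half, leaf chunks C (16 leaves)
(cell `pub-ising3x`, seat controls-1 gen 19; KERNEL PATH for the 2D γ-certificates, Λ = 19 — CONTROL-ONLY)

HONEST FRAMING: lottery ticket; floor = tightest certified 3D Ising CFT bounds; no exact-solution
claim without a proof. CONTROL-ONLY (`d = 2`, `Δ_σ = 1/8`, the 2D Ising control).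

(R) for the table `wtgapC` (`Control2DL19GapCTable`), kernel data only: the compactified region polynomial `QhatgapC`
(`S₁ = 96`, `d = 19`) is non-negative on `τ ∈ [0,1]`, `v ∈ [0,1]` by the tensor-Bernstein SHAPE tree `creggapC`
(86 leaves; every Bernstein coefficient computed and decided in the kernel, `Control2DPolyCertAuto2`, in 18 chunks of
≤ 12 leaves re-assembled along the splits), and `S ≤ S₁` by the per-`J` shapes `cregJgapC` of the Table file;
the root fact `creggapC_n0` and the per-`J` fact `cregJgapC_ok` are turned into hypothesis `hR` by `region_of_kernelCertAuto` INSIDE the assembly file `Control2DL19GapC` (no standalone `region_gapC` theorem: its statement would coincide, up to the table's name, with the other Λ = 19 boxes' — gate dedup lint, controls-1 g17). No facts, standard axioms only.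

SPLIT (controls-1 g19): the gate caps one file at 600 s of elaboration and the whole 86-leaf tree took 613 s, so the kernel-decided
leaf CHUNKS live in `Control2DL19GapCRegionA…` files (≤ 18 leaves each) and `Control2DL19GapCRegion` re-assembles the nodes. This file: chunks creggapC_n22, creggapC_n23, creggapC_n24, creggapC_n26.
-/

namespace Summit.CriticalPhenomena.Ising3D.Control2D

open Literature.MathematicalPhysics.QuantumFieldTheory.ConformalBootstrap3D

set_option maxHeartbeats 0 in
set_option maxRecDepth 200000 in
/-- Chunk 22 of the large-`S` tree (box `q₁=64, a₁=13; q₂=32, a₂=27`; 8 leaves), decided in the kernel. [folklore] -/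
theorem creggapC_n22 :
    checkAuto₂ QhatgapC 20 64 13 1 32 27 1
    (Shape₂.splitI (Shape₂.splitO (Shape₂.splitI (Shape₂.splitO (Shape₂.splitI (Shape₂.leaf) (Shape₂.leaf)) (Shape₂.splitI (Shape₂.leaf) (Shape₂.leaf))) (Shape₂.leaf)) (Shape₂.splitI (Shape₂.leaf) (Shape₂.leaf))) (Shape₂.leaf)) = true := by
  decide +kernel

set_option maxHeartbeats 0 in
set_option maxRecDepth 200000 in
/-- Chunk 23 of the large-`S` tree (box `q₁=32, a₁=7; q₂=16, a₂=13`; 4 leaves), decided in the kernel. [folklore] -/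
theorem creggapC_n23 :
    checkAuto₂ QhatgapC 20 32 7 1 16 13 1
    (Shape₂.splitI (Shape₂.leaf) (Shape₂.splitO (Shape₂.splitI (Shape₂.leaf) (Shape₂.leaf)) (Shape₂.leaf))) = true := by
  decide +kernel

set_option maxHeartbeats 0 in
set_option maxRecDepth 200000 in
/-- Chunk 24 of the large-`S` tree (box `q₁=8, a₁=1; q₂=8, a₂=7`; 3 leaves), decided in the kernel. [folklore] -/
theorem creggapC_n24 :
    checkAuto₂ QhatgapC 20 8 1 1 8 7 1
    (Shape₂.splitO (Shape₂.leaf) (Shape₂.splitI (Shape₂.leaf) (Shape₂.leaf))) = true := by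
  decide +kernel

set_option maxHeartbeats 0 in
set_option maxRecDepth 200000 in
/-- Chunk 26 of the large-`S` tree (box `q₁=4, a₁=1; q₂=4, a₂=2`; 1 leaves), decided in the kernel. [folklore] -/
theorem creggapC_n26 :
    checkAuto₂ QhatgapC 20 4 1 1 4 2 1
    (Shape₂.leaf) = true := by
  decide +kernel

end Summit.CriticalPhenomena.Ising3D.Control2D
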